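import Mathlib
import Summits.AtomisticToContinuum.Crystallization.Theorems.GappedShellCensusCleanLimitsHaveWindowsLaminarDefs

/-!
# Zero laminar defect at a gapped-twelve site ⇒ exactly laminar bond shell

Crux `GappedShellCensus.CleanLimitsHaveWindows` (stmt-AtomisticToContinuum-15932), line `Sketch`, stub
`stub_laminarShellOfDefectZero` (R4a). If the bond shell of `p` has exactly twelve points and the laminar defect
`laminarDefect a Z p` vanishes, then the bond shell IS a laminar shell `p + laminarSlotC u v w₁ w₂ (Fin 12)` or
`p + laminarSlotH u v w₁ w₂ (Fin 12)`.

Proof. The labellings `↥(bondShell a Z p) ≃ Fin 12` form a finite non-empty type (`ncard = 12`), so the outer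
infimum is attained at some labelling `e`. For fixed `e` the two-type position misfit is a continuous function of the
slot parameters `θ = (u, v, w₁, w₂) ∈ (ℝ³)⁴`; it is COERCIVE, since the slots `0, 2, 6, 9` of both slot models are
`u, v, w₁, w₂` and hence each misfit dominates `‖q 0 − p − u‖²`, `‖q 2 − p − v‖²`, `‖q 6 − p − w₁‖²`,
`‖q 9 − p − w₂‖²`: its sublevel sets are bounded in the proper space `(ℝ³)⁴`, so the inner infimum is a minimum
(`Continuous.exists_forall_le_of_isBounded`), which is `0`. At a zero of a position misfit (a sum of squares) every
residual vanishes, `q k = p + slot k` for all `k`, and the shell is the range of `p + slot ·`.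
-/

noncomputable section

namespace Summit.AtomisticToContinuum.Crystallization.Theorems.CleanHull

open Literature.MathematicalPhysics.StatisticalMechanics

/-! ## The laminar slot models: distinguished slots and continuity in the parameters -/

/-- The slots `0, 2, 6, 9` of the cubic laminar model are `u, v, w₁, w₂`. [folklore] -/
theorem laminarSlotC_apply_0269 (u v w₁ w₂ : EuclideanSpace ℝ (Fin 3)) :
    laminarSlotC u v w₁ w₂ 0 = u ∧ laminarSlotC u v w₁ w₂ 2 = v ∧ laminarSlotC u v w₁ w₂ 6 = w₁ ∧
      laminarSlotC u v w₁ w₂ 9 = w₂ := by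
  simp [laminarSlotC]

/-- The slots `0, 2, 6, 9` of the hexagonal laminar model are `u, v, w₁, w₂`. [folklore] -/
theorem laminarSlotH_apply_0269 (u v w₁ w₂ : EuclideanSpace ℝ (Fin 3)) :
    laminarSlotH u v w₁ w₂ 0 = u ∧ laminarSlotH u v w₁ w₂ 2 = v ∧ laminarSlotH u v w₁ w₂ 6 = w₁ ∧
      laminarSlotH u v w₁ w₂ 9 = w₂ := by
  simp [laminarSlotH]

/-- Each cubic laminar slot is a continuous function of the parameters `(u, v, w₁, w₂)`. [folklore] -/
theorem continuous_laminarSlotC_apply (k : Fin 12) :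
    Continuous fun θ : EuclideanSpace ℝ (Fin 3) × EuclideanSpace ℝ (Fin 3) × EuclideanSpace ℝ (Fin 3) ×
        EuclideanSpace ℝ (Fin 3) => laminarSlotC θ.1 θ.2.1 θ.2.2.1 θ.2.2.2 k := by
  fin_cases k <;> simp [laminarSlotC] <;> fun_prop

/-- Each hexagonal laminar slot is a continuous function of the parameters `(u, v, w₁, w₂)`. [folklore] -/
theorem continuous_laminarSlotH_apply (k : Fin 12) :
    Continuous fun θ : EuclideanSpace ℝ (Fin 3) × EuclideanSpace ℝ (Fin 3) × EuclideanSpace ℝ (Fin 3) ×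
        EuclideanSpace ℝ (Fin 3) => laminarSlotH θ.1 θ.2.1 θ.2.2.1 θ.2.2.2 k := by
  fin_cases k <;> simp [laminarSlotH] <;> fun_prop

/-! ## The position misfit: continuity, single-residual lower bound, zeros -/

/-- The position misfit against a slot model all of whose slots vary continuously is continuous. [folklore] -/
theorem continuous_posMisfit_comp {X : Type*} [TopologicalSpace X] (p : EuclideanSpace ℝ (Fin 3))
    (q : Fin 12 → EuclideanSpace ℝ (Fin 3)) {s : X → Fin 12 → EuclideanSpace ℝ (Fin 3)}
    (hs : ∀ k, Continuous fun x => s x k) : Continuous fun x => posMisfit p q (s x) := by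
  unfold posMisfit
  fun_prop

/-- A single squared residual is dominated by the position misfit. [folklore] -/
theorem norm_sq_le_posMisfit (p : EuclideanSpace ℝ (Fin 3)) (q slot : Fin 12 → EuclideanSpace ℝ (Fin 3))
    (k : Fin 12) : ‖q k - p - slot k‖ ^ 2 ≤ posMisfit p q slot :=
  Finset.single_le_sum (f := fun k => ‖q k - p - slot k‖ ^ 2) (fun _ _ => sq_nonneg _) (Finset.mem_univ k)

/-- If the position misfit is at most `c`, every slot lies in the closed ball of radius `√c` about the
corresponding centred cluster point. [folklore] -/
theorem slot_mem_closedBall_of_posMisfit_le {p : EuclideanSpace ℝ (Fin 3)}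
    {q slot : Fin 12 → EuclideanSpace ℝ (Fin 3)} {c : ℝ} (h : posMisfit p q slot ≤ c) (k : Fin 12) :
    slot k ∈ Metric.closedBall (q k - p) (Real.sqrt c) := by
  rw [Metric.mem_closedBall, dist_eq_norm, norm_sub_rev]
  exact Real.le_sqrt_of_sq_le ((norm_sq_le_posMisfit p q slot k).trans h)

/-- At a zero of the position misfit every residual vanishes: `q k = p + slot k`. [folklore] -/
theorem eq_of_posMisfit_eq_zero {p : EuclideanSpace ℝ (Fin 3)} {q slot : Fin 12 → EuclideanSpace ℝ (Fin 3)}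
    (h : posMisfit p q slot = 0) (k : Fin 12) : q k = p + slot k := by
  unfold posMisfit at h
  rw [Finset.sum_eq_zero_iff_of_nonneg fun _ _ => sq_nonneg _] at h
  have hk := (pow_eq_zero_iff two_ne_zero).mp (h k (Finset.mem_univ _))
  rwa [norm_eq_zero, sub_eq_zero, sub_eq_iff_eq_add'] at hk

/-- A labelled shell with zero position misfit against a slot model is the range of `p + slot ·`. [folklore] -/
theorem shell_eq_range_of_posMisfit_eq_zero {S : Set (EuclideanSpace ℝ (Fin 3))} {p : EuclideanSpace ℝ (Fin 3)}
    (e : ↥S ≃ Fin 12) {slot : Fin 12 → EuclideanSpace ℝ (Fin 3)}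
    (h : posMisfit p (fun k => (e.symm k : EuclideanSpace ℝ (Fin 3))) slot = 0) :
    S = Set.range fun k : Fin 12 => p + slot k := by
  have hk : ∀ k, (e.symm k : EuclideanSpace ℝ (Fin 3)) = p + slot k := eq_of_posMisfit_eq_zero h
  refine Set.ext fun w => ⟨fun hw => ⟨e ⟨w, hw⟩, ?_⟩, ?_⟩
  · show p + slot (e ⟨w, hw⟩) = w
    rw [← hk, Equiv.symm_apply_apply]
  · rintro ⟨k, rfl⟩
    show p + slot k ∈ S
    rw [← hk]
    exact (e.symm k).2

/-! ## Attainment of the inner infimum (coercivity) -/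

/-- For a fixed labelled cluster, the two-type laminar misfit attains its infimum over the (non-compact) slot
parameter space `(ℝ³)⁴`: it is continuous with bounded sublevel sets. [folklore] -/
theorem exists_laminarParam_isMin (p : EuclideanSpace ℝ (Fin 3)) (q : Fin 12 → EuclideanSpace ℝ (Fin 3)) :
    ∃ θ₀ : EuclideanSpace ℝ (Fin 3) × EuclideanSpace ℝ (Fin 3) × EuclideanSpace ℝ (Fin 3) × EuclideanSpace ℝ (Fin 3),
      ∀ θ : EuclideanSpace ℝ (Fin 3) × EuclideanSpace ℝ (Fin 3) × EuclideanSpace ℝ (Fin 3) × EuclideanSpace ℝ (Fin 3),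
        min (posMisfit p q (laminarSlotC θ₀.1 θ₀.2.1 θ₀.2.2.1 θ₀.2.2.2))
            (posMisfit p q (laminarSlotH θ₀.1 θ₀.2.1 θ₀.2.2.1 θ₀.2.2.2)) ≤
          min (posMisfit p q (laminarSlotC θ.1 θ.2.1 θ.2.2.1 θ.2.2.2))
            (posMisfit p q (laminarSlotH θ.1 θ.2.1 θ.2.2.1 θ.2.2.2)) := by
  have hcont : Continuous fun θ : EuclideanSpace ℝ (Fin 3) × EuclideanSpace ℝ (Fin 3) ×
      EuclideanSpace ℝ (Fin 3) × EuclideanSpace ℝ (Fin 3) =>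
      min (posMisfit p q (laminarSlotC θ.1 θ.2.1 θ.2.2.1 θ.2.2.2))
        (posMisfit p q (laminarSlotH θ.1 θ.2.1 θ.2.2.1 θ.2.2.2)) :=
    (continuous_posMisfit_comp p q continuous_laminarSlotC_apply).min
      (continuous_posMisfit_comp p q continuous_laminarSlotH_apply)
  refine hcont.exists_forall_le_of_isBounded 0 ?_
  set c : ℝ := min (posMisfit p q (laminarSlotC (0 : EuclideanSpace ℝ (Fin 3) × EuclideanSpace ℝ (Fin 3) ×
      EuclideanSpace ℝ (Fin 3) × EuclideanSpace ℝ (Fin 3)).1 (0 : EuclideanSpace ℝ (Fin 3) ×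
      EuclideanSpace ℝ (Fin 3) × EuclideanSpace ℝ (Fin 3) × EuclideanSpace ℝ (Fin 3)).2.1
      (0 : EuclideanSpace ℝ (Fin 3) × EuclideanSpace ℝ (Fin 3) × EuclideanSpace ℝ (Fin 3) ×
        EuclideanSpace ℝ (Fin 3)).2.2.1 (0 : EuclideanSpace ℝ (Fin 3) × EuclideanSpace ℝ (Fin 3) ×
        EuclideanSpace ℝ (Fin 3) × EuclideanSpace ℝ (Fin 3)).2.2.2))
    (posMisfit p q (laminarSlotH (0 : EuclideanSpace ℝ (Fin 3) × EuclideanSpace ℝ (Fin 3) ×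
      EuclideanSpace ℝ (Fin 3) × EuclideanSpace ℝ (Fin 3)).1 (0 : EuclideanSpace ℝ (Fin 3) ×
      EuclideanSpace ℝ (Fin 3) × EuclideanSpace ℝ (Fin 3) × EuclideanSpace ℝ (Fin 3)).2.1
      (0 : EuclideanSpace ℝ (Fin 3) × EuclideanSpace ℝ (Fin 3) × EuclideanSpace ℝ (Fin 3) ×
        EuclideanSpace ℝ (Fin 3)).2.2.1 (0 : EuclideanSpace ℝ (Fin 3) × EuclideanSpace ℝ (Fin 3) ×
        EuclideanSpace ℝ (Fin 3) × EuclideanSpace ℝ (Fin 3)).2.2.2)) with hc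
  refine ((Metric.isBounded_closedBall (x := q 0 - p) (r := Real.sqrt c)).prod
    ((Metric.isBounded_closedBall (x := q 2 - p) (r := Real.sqrt c)).prod
    ((Metric.isBounded_closedBall (x := q 6 - p) (r := Real.sqrt c)).prod
    (Metric.isBounded_closedBall (x := q 9 - p) (r := Real.sqrt c))))).subset ?_
  intro θ hθ
  simp only [Set.mem_setOf_eq] at hθ
  simp only [Set.mem_prod]
  rcases min_le_iff.mp hθ with h | h
  · obtain ⟨e0, e2, e6, e9⟩ := laminarSlotC_apply_0269 θ.1 θ.2.1 θ.2.2.1 θ.2.2.2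
    exact ⟨e0 ▸ slot_mem_closedBall_of_posMisfit_le h 0, e2 ▸ slot_mem_closedBall_of_posMisfit_le h 2,
      e6 ▸ slot_mem_closedBall_of_posMisfit_le h 6, e9 ▸ slot_mem_closedBall_of_posMisfit_le h 9⟩
  · obtain ⟨e0, e2, e6, e9⟩ := laminarSlotH_apply_0269 θ.1 θ.2.1 θ.2.2.1 θ.2.2.2
    exact ⟨e0 ▸ slot_mem_closedBall_of_posMisfit_le h 0, e2 ▸ slot_mem_closedBall_of_posMisfit_le h 2,
      e6 ▸ slot_mem_closedBall_of_posMisfit_le h 6, e9 ▸ slot_mem_closedBall_of_posMisfit_le h 9⟩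

/-! ## The stub -/

/-- **Stub R4a (zero laminar defect ⇒ an exactly laminar shell).** At a gapped-twelve site the laminar defect vanishes only
if the bond shell IS a laminar shell `p + laminarSlotC u v w₁ w₂ (Fin 12)` or `p + laminarSlotH u v w₁ w₂ (Fin 12)`: the labelling type
is finite and non-empty (`ncard = 12`), and for a fixed labelling the position misfit is a continuous COERCIVE function of the slot
parameters (`≥ ‖q 0 − p − u‖² + ‖q 2 − p − v‖² + ‖q 6 − p − w₁‖² + ‖q 9 − p − w₂‖²`), so a zero infimum is attained and every residual
vanishes. Pattern: the landed `exists_clusterMisfit_eq_zero` / `stub_exactShellOfDefectZero`. [folklore] -/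
theorem stub_laminarShellOfDefectZero : ∀ (Z : Set (EuclideanSpace ℝ (Fin 3))) (a : ℝ), 0 < a →
    ∀ p ∈ Z, ({w ∈ Z | w ≠ p ∧ dist p w ≤ a * (1 + 1 / 50)}.ncard = 12 ∧
      ∀ w ∈ Z, w ≠ p → a * (1 - 1 / 50) ≤ dist p w ∧ (dist p w ≤ a * (1 + 1 / 50) ∨ a * (63 / 50) ≤ dist p w)) →
    laminarDefect a Z p = 0 →
    ∃ u v w₁ w₂ : EuclideanSpace ℝ (Fin 3),
      (bondShell a Z p = Set.range fun k : Fin 12 => p + laminarSlotC u v w₁ w₂ k) ∨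
      (bondShell a Z p = Set.range fun k : Fin 12 => p + laminarSlotH u v w₁ w₂ k) := by
  intro Z a _ p _ hgap hd
  have hS : (bondShell a Z p).ncard = 12 := hgap.1
  have hfin : (bondShell a Z p).Finite := Set.finite_of_ncard_ne_zero (by omega)
  haveI := hfin.to_subtype
  have hcard : Nat.card ↥(bondShell a Z p) = 12 := by rw [Nat.card_coe_set_eq]; exact hS
  haveI : Nonempty (↥(bondShell a Z p) ≃ Fin 12) := ⟨Finite.equivFinOfCardEq hcard⟩
  obtain ⟨e, he⟩ := exists_eq_ciInf_of_finite (f := fun e : ↥(bondShell a Z p) ≃ Fin 12 =>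
    ⨅ θ : EuclideanSpace ℝ (Fin 3) × EuclideanSpace ℝ (Fin 3) × EuclideanSpace ℝ (Fin 3) × EuclideanSpace ℝ (Fin 3),
      min (posMisfit p (fun k => (e.symm k : EuclideanSpace ℝ (Fin 3))) (laminarSlotC θ.1 θ.2.1 θ.2.2.1 θ.2.2.2))
        (posMisfit p (fun k => (e.symm k : EuclideanSpace ℝ (Fin 3))) (laminarSlotH θ.1 θ.2.1 θ.2.2.1 θ.2.2.2)))
  obtain ⟨θ₀, hθ₀⟩ := exists_laminarParam_isMin p fun k => (e.symm k : EuclideanSpace ℝ (Fin 3))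
  have hle : min (posMisfit p (fun k => (e.symm k : EuclideanSpace ℝ (Fin 3)))
        (laminarSlotC θ₀.1 θ₀.2.1 θ₀.2.2.1 θ₀.2.2.2))
      (posMisfit p (fun k => (e.symm k : EuclideanSpace ℝ (Fin 3)))
        (laminarSlotH θ₀.1 θ₀.2.1 θ₀.2.2.1 θ₀.2.2.2)) ≤ laminarDefect a Z p :=
    (le_ciInf hθ₀).trans_eq he
  have hval : min (posMisfit p (fun k => (e.symm k : EuclideanSpace ℝ (Fin 3)))
        (laminarSlotC θ₀.1 θ₀.2.1 θ₀.2.2.1 θ₀.2.2.2))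
      (posMisfit p (fun k => (e.symm k : EuclideanSpace ℝ (Fin 3)))
        (laminarSlotH θ₀.1 θ₀.2.1 θ₀.2.2.1 θ₀.2.2.2)) = 0 :=
    le_antisymm (hle.trans_eq hd) (le_min (posMisfit_nonneg _ _ _) (posMisfit_nonneg _ _ _))
  refine ⟨θ₀.1, θ₀.2.1, θ₀.2.2.1, θ₀.2.2.2, ?_⟩
  rcases min_eq_iff.mp hval with ⟨h, -⟩ | ⟨h, -⟩
  · exact Or.inl (shell_eq_range_of_posMisfit_eq_zero e h)
  · exact Or.inr (shell_eq_range_of_posMisfit_eq_zero e h)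

end Summit.AtomisticToContinuum.Crystallization.Theorems.CleanHull

end
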